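import Summits.AtomisticToContinuum.BoseEinsteinCondensation.Theses.BECInfDivCoherence
import Summits.AtomisticToContinuum.BoseEinsteinCondensation.Theorems.BECInfDivCoherenceLevyNegativeMomentCosSumVanishes
import Summits.AtomisticToContinuum.BoseEinsteinCondensation.Theorems.BECInfDivCoherenceLevyNegativeMomentRieszSum

/-!
# Birth skeleton for crux `LevyNegativeMoment` (stmt-AtomisticToContinuum-9115)

Route `BECInfDivCoherence` (route-AtomisticToContinuum-BECInfDivCoherence), sub-problem
`BoseEinsteinCondensation`, crux rank 3.  Registered by planner-skel-stmt-AtomisticToContinuum-9115-0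
(2026-08-17, skeleton-register one-shot).  `Disproof.lean` for this crux: none exists
(`ledger crux ls stmt-AtomisticToContinuum-9115`: no workfiles) — nothing to honour or avoid yet.

## The crux

For near-minimisers `Ψ` of the periodic `N`-body energy (torus of side `L = (N/ρ)^(1/3)`), grid
`m = ⌊L/η⌋`, translation coherence `G(r) = Re ∫ conj Ψ(…, xᵢ + r, …) Ψ`, grid values
`F(j) = log G((L/m) j)` and discrete Lévy weights `ν̃_q = m⁻³ Σ_j F(j) cos(2π q·j/m)`:
`Σ_(q≢0) max(ν̃_q, 0)/|k_q| ≤ C`, `|k_q| = (2π/L)‖q̄‖`, with `C = C(v, η)` uniform in `N` and in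
`ρ → 0` (route file, item docstring; Bogoliubov value `√2·a/π`).

## The line (three stubs, composition kernel-checked)

Jordan-decompose `ν̃⁺ = ν̃ + ν̃⁻` and treat the two halves by different mechanisms.

* The SIGNED (−1)-moment `Σ_(q≢0) ν̃_q/|k_q|` is LINEAR in `F = log G`: exchanging the two finite sums,
  `Σ_(q≢0) ν̃_q/|k_q| = Σ_j F(j)·K(j)` with the GRID RIESZ KERNEL
  `K(j) = Σ_(q≢0) cos(2π q·j/m) / m³ / |k_q|` (`≈ h/(2π²|j|²)`, `h = L/m`; the grid version of the
  `|k|⁻¹ ↔ 1/(2π²r²)` transform of card M4).  `K` has ZERO MEAN over the grid (`Σ_j cos(2π q·j/m) = 0`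
  for `q ≢ 0`: roots of unity), so any constant may be subtracted from `F`:
  `Σ_j F(j)K(j) = Σ_j (F(j) − c)K(j) ≤ Σ_j |F(j) − c|·|K(j)|`.
  - `stub_rieszKernel : RieszKernelBound` — pure discrete harmonic analysis, provable now [size M/L]:
    an absolute `A ≥ 0` with `|K(j)| ≤ A·h/(1 + ‖j‖²_per)` for all `m, L > 0, j`
    (`‖j‖²_per = Σ_k min(j_k, m − j_k)²`), and the exact zero-mean identity `Σ_j K(j) = 0`.
    (Heuristics: `K(0) = (L/2πm³)Σ_(q≠0) 1/‖q̄‖ ≈ 0.39·h`; for `j ≠ 0` the DFT of `‖q̄‖⁻¹` on the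
    discrete cube is `h/(2π²‖j‖²)` plus same-order cube-truncation terms — the faces contribute at
    second order only because `‖q̄‖⁻¹` is even in each coordinate.)
  - `stub_logClusterL1 : LogClusterL1` — the physics [size XL, the HARDEST stub]: for every admissible
    `v` and every `η > 0`, constants `C₁(v, η)`, `ρ₀` such that near-minimisers satisfy, for SOME
    centring constant `c` (free: `c = log f₀` or the grid mean are the natural choices),
    `Σ_j |log G(r_j) − c| · h/(1 + ‖j‖²_per) ≤ C₁` uniformly in `N` and `ρ` — the weighted-ℓ¹
    (integrated) form of the card's LOGCLUSTER estimate K2 (`≈ ∫ |log G − c| dr/(h² + r²)`;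
    Bogoliubov: near field `4πξ·|log f₀| = O(a)`, far field `∫ (aξ/r²) dr/r² · r² = O(a)`).
    WHY IT MIGHT FAIL (sharpened here): the near-field term is `≈ 4π ξ Λ` (`Λ` = total Lévy mass ≈
    depletion), so `ρ`-uniformity forces the OPTIMAL depletion rate `Λ = O(a/ξ) = O(√(ρa³))` for
    near-minimisers in the thermodynamic limit — the same strength the crux itself hides (its kernel is
    positive on the near field), far beyond LSSY/GP-regime condensation; meets
    `Literature.Barriers.AtomisticToContinuum.BogoliubovPerturbationInfrared` if attacked by expansion.
* The NEGATIVE part: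
  - `stub_schoenbergDefect : LevyNegativePartMoment` — `Σ_(q≢0) max(−ν̃_q, 0)/|k_q| ≤ C₂(v, η)`
    uniformly [size M/L]: quantitative infrared infinite divisibility at every grid scale (the
    Schoenberg side of the thesis).  At the UV scale `η` of the sister crux `GridInfDivCoherence` it
    follows from that crux with `ε = ε(N)` (`δ` is chosen after `N` in both); at other scales it is the
    weighted-ℓ¹ tolerance of the known UV negative weights (`|k| ~ π/a`, mass ~1e-6 for `N = 2`), which
    aliasing spreads over `m³` classes (`≲ μ₋·η/2π`, `N`-uniform if the negative mass `μ₋` is).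
* `LevyNegativeMoment_of : RieszKernelBound → LogClusterL1 → LevyNegativePartMoment → LevyNegativeMoment`
  — PROVED below (no sorry): quantifier threading (`C = A·C₁ + C₂`, `ρ₀ = min`, `Eventually.and` with
  `N > 0` for `L > 0`, `δ = min`), the exchange-of-sums / centring / domination lemma `signed_le`, and
  the Jordan seam `sum_max_div_le` (`max x 0 = x + max (−x) 0`).

## Reshape r1 (lead prover-line-…-9115-c1-0, 2026-08-17)

`stub_rieszKernel` is now DERIVED (no sorry of its own) from two L-free registered stubs by
`rieszKernelBound_of` (rescaling `L/(2π m³)`, kernel-checked):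
  - `stub_rieszSum : RieszSumBound` — `|Σ_(q≢0) cos(2π q·j/m)/‖q̄‖| ≤ A·m²/(1+‖j‖²_per)` [L, held by the lead];
  - `stub_cosSumVanishes : CosSumVanishes` — `Σ_j cos(2π q·j/m) = 0` for `q ≢ 0` [S].
Registered stubs after r1: `stub_rieszSum`, `stub_cosSumVanishes`, `stub_logClusterL1`, `stub_schoenbergDefect`.
`stub_cosSumVanishes` LANDED 2026-08-17 (p143925) and `stub_rieszSum` LANDED 2026-08-17 (RieszSum chain); both are imported.
Open stubs: `stub_logClusterL1`, `stub_schoenbergDefect` (the physics; see the wave-1 assessments attached to the crux item).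

## Cycle 2 (lead prover-line-…-9115-c2-0, 2026-08-17): target strength, kernel-checked

No reshape (the composition cannot be made cheaper than the crux, and the crux is itself ≥ the route
target, see below); the two open stubs are unchanged.  Landed `--supports` this cycle:
`Theorems/BECInfDivCoherenceLevyNegativeMomentGridMeanLog.lean` (p147933) and
`Theorems/BECInfDivCoherenceLevyNegativeMomentTargetStrength.lean` (p149324) —
  * `|k_q| ≤ 2√3π m/L`, hence the crux's (−1)-moment bound ALREADY bounds the total positive Lévy mass,
    `Σ_(q≢0) ν̃⁺_q ≤ (2√3π/η)·C`, and (with `Σ_q ν̃_q = log G(0) = 0`) the grid mean of `log G_Ψ` from below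
    (`gridMeanLog_of_levyNegativeMoment`); the registered `stub_logClusterL1` gives the same floor by
    anchoring at `j = 0` (`gridMeanLog_of_logClusterL1`);
  * such a floor + POSITIVITY of the coherence of near-minimisers (first conjunct of `GridInfDivCoherence`)
    + the proved `GridAverageCondensate` give the route target (body of `BECPeriodicReduction.PeriodicBEC`,
    the conclusion of the glue `LevyMassCondensation`): `periodicBEC_of_levyNegativeMoment_of_coherencePos`,
    `periodicBEC_of_logClusterL1_of_coherencePos`, `periodicBEC_of_gridInfDivCoherence_pos_of_levyNegativeMoment`.
So `stub_logClusterL1` (and the crux) are at least PeriodicBEC-strength; the `ν̃ ≥ −ε` clause of the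
sister crux is idle for the route; only one grid scale and the `ρ`-uniformity of `C` are ever used.

## Cycle 3 (lead prover-line-…-9115-c3-0, 2026-08-17): target strength made UNCONDITIONAL on the bounded sector

No reshape (same two open stubs; wave: none — both are open-problem physics with standing wave-1
assessments).  Landed `--supports` this cycle:
`Theorems/BECInfDivCoherenceLevyNegativeMomentCoherencePosBounded.lean` (p152808) and
`Theorems/BECInfDivCoherenceLevyNegativeMomentTargetStrengthBounded.lean` (p153098) —
  * `CoherencePos.coherencePos_of_bounded`: for every BOUNDED admissible `v` (measurable, finite range,
    `v ≤ M < ∞`), every `N` and `L > 0` there is `δ > 0` such that every `δ`-near-minimiser of the periodic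
    energy has translation coherence `G_Φ(i,r) > 0` for all `i, r` (positive `C¹` minimiser
    `boundedPositiveMinimiser_holds` + gap `PeriodicGroundStateNondegenerate_holds` + `G` is `2`-Lipschitz in
    `L²(cell)` and phase-blind + uniform floor of `G_{Ψ₀}` by periodicity/compactness) — this DISCHARGES the
    positivity hypothesis of cycle 2's certificate on the bounded class (and is the first conjunct of the
    sister crux `GridInfDivCoherence` there, at fixed `N, L`);
  * `periodicBEC_clause_of_levyNegativeMoment_bounded`, `periodicBEC_clause_of_logClusterL1_bounded`,
    `periodicBEC_bounded_of_levyNegativeMoment`: the CRUX ALONE, and the registered stub `stub_logClusterL1`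
    ALONE, imply the `PeriodicBEC` clause (stmt-0826) of every bounded repulsive finite-range potential —
    i.e. Bose–Einstein condensation of the dilute soft-sphere gas in the thermodynamic limit, with no side
    hypothesis.  Hence no line through this crux can be cheaper than the (bounded sector of the) open
    sub-problem; the crux should be parked behind stmt-0826 / the route restated (planner level).

## Cycle 4 (lead prover-line-…-9115-c4-0, 2026-08-17): integrable sector, and the park on stmt-0826 retired

No reshape (same two open stubs; wave: none — both carry standing wave-1 worker replies and no new
input exists: no `Disproof.lean`, empty TTRL library, no evidence since cycle 3).  New facts used:
stmt-0826 `PeriodicBEC` is CLOSED-AS-MOOT (it is the sub-problem target itself), so cycle 3's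
`blocked-on: stmt-0826` is not an admissible park; the sister line (stmt-9114) has PROVED coherence
positivity of near-minimisers for every INTEGRABLE admissible profile (`stub_coherencePos_integrable`).
Landed `--supports` this cycle: `Theorems/BECInfDivCoherenceLevyNegativeMomentTargetStrengthIntegrable.lean`
— the CRUX ALONE, and `stub_logClusterL1` ALONE, imply the `PeriodicBEC` clause of every integrable
repulsive finite-range potential (bounded or not), and with 0827 the conjunct's `HasGroundStateBEC`
there; for non-integrable profiles (hard cores) the same holds modulo the 9114 line's residues
(Lemma G / PF_ess).  Outcome: `promote-stub` (stub_logClusterL1 is crux-sized — indeed target-sized);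
planner action recommended: close or restate the route, do not re-line 9115.

## Audit (2026-08-17, `lean check --json`)

rc 0; sorries = 3 = stubs (`stub_rieszKernel`, `stub_logClusterL1`, `stub_schoenbergDefect`), zero
elsewhere; `#print axioms LevyNegativeMoment_of` = [propext, Classical.choice, Quot.sound] (no sorryAx);
H21 audit: `LevyNegativeMoment_of` "proves …Theses.BECInfDivCoherence.LevyNegativeMoment" (by name) under
exactly the three stub statements.  BC3 probes (folder `bc/probe4_*.lean`, stub statement re-declared,
birth file NOT imported; tactics run one per `example`: `exact?` · `simpa [S]` · `unfold S; simpa` ·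
`aesop` · `intro h; unfold S at h; exact?`, `maxHeartbeats 400000` each): for every stub S, both
`S → LevyNegativeMoment` and `S → _root_.BoseEinsteinCondensation` FAIL on all five tactics
(`exact?` could not close the goal / `assumption` failed after simp / aesop: failed after exhaustive
search) — 6/6 probes failed, no stub is cheaply the crux or the summit.  Numerics for stub 1
(`bc/riesz_check*.py`, pure python, m ≤ 32): `sup_j |K(j)|(1+‖j‖²_per)/h = 0.378` (attained at j = 0,
increasing to (1/2π)∫_cube du/|u| ≈ 0.38), corner ratio 0.21 stable, `Σ_j K(j) = O(1e-15)`.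
-/

namespace Summit.AtomisticToContinuum.BoseEinsteinCondensation.Cruxes.LevyNegativeMoment.Birth

open scoped BigOperators Topology Manifold Classical MeasureTheory ProbabilityTheory Matrix InnerProductSpace ComplexConjugate ContinuousMap
open Filter Set Function TopologicalSpace MeasureTheory

/-- GRID RIESZ KERNEL BOUND (pure discrete harmonic analysis): the zero-mean kernel
`K_(m,L)(j) = Σ_(q≢0) cos(2π q·j/m)/m³/|k_q|` is dominated by `A·(L/m)/(1 + ‖j‖²_per)` with an
absolute constant `A`, and has grid mean zero. -/
def RieszKernelBound : Prop :=
  ∃ A : ℝ, 0 ≤ A ∧ ∀ (m : ℕ) (L : ℝ), 0 < L → (∀ j : Fin 3 → Fin m, |∑ q : Fin 3 → Fin m with (∃ k, (q k : ℕ) ≠ 0), Real.cos (2 * Real.pi * (∑ k, ((q k : ℕ) : ℝ) * ((j k : ℕ) : ℝ)) / m) / (m : ℝ) ^ 3 / (2 * Real.pi / L * Real.sqrt (∑ k, ((min (q k : ℕ) (m - (q k : ℕ)) : ℕ) : ℝ) ^ 2))| ≤ A * ((L / m) / (1 + ∑ k, ((min (j k : ℕ) (m - (j k : ℕ)) : ℕ)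 : ℝ) ^ 2))) ∧ ∑ j : Fin 3 → Fin m, (∑ q : Fin 3 → Fin m with (∃ k, (q k : ℕ) ≠ 0), Real.cos (2 * Real.pi * (∑ k, ((q k : ℕ) : ℝ) * ((j k : ℕ) : ℝ)) / m) / (m : ℝ) ^ 3 / (2 * Real.pi / L * Real.sqrt (∑ k, ((min (q k : ℕ) (m - (q k : ℕ)) : ℕ) : ℝ) ^ 2))) = 0

/-- WEIGHTED-ℓ¹ LOG-CLUSTER BOUND (the physics): for near-minimisers, the centred log-coherence on
the grid is summable against the Riesz weight `h/(1 + ‖j‖²_per)`, uniformly in `N` and `ρ → 0`,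
for some centring constant `c`. -/
def LogClusterL1 : Prop :=
  ∀ v : ℝ → ENNReal, Literature.MathematicalPhysics.QuantumManyBody.BoseGas.IsRepulsiveFiniteRange v → ∀ η : ℝ, 0 < η → ∃ C : ℝ, ∃ ρ₀ : ℝ, 0 < ρ₀ ∧ ∀ ρ : ℝ, 0 < ρ → ρ < ρ₀ → ∀ᶠ N : ℕ in Filter.atTop, ∃ δ : ENNReal, 0 < δ ∧ ∀ Ψ : Literature.MathematicalPhysics.QuantumManyBody.BoseGas.PeriodicTrialState N (Literature.MathematicalPhysics.QuantumManyBody.BoseGas.sideLength ρ N), Literature.MathematicalPhysics.QuantumManyBody.BoseGas.periodicEnergy v Ψ ≤ Literature.MathematicalPhysics.QuantumManyBody.BoseGas.periodicGroundStateEnergy v N (Literature.MathematicalPhysics.QuantumManyBody.BoseGas.sideLength ρ N) + δ → ∀ i : Fin N, let L : ℝ := Literature.MathematicalPhysics.QuantumManyBody.BoseGas.sideLength ρ N; let m : ℕ := ⌊L / η⌋₊; let G : EuclideanSpace ℝ (Fin 3) → ℝ := fun r => (∫ X in Literature.MathematicalPhysics.QuantumManyBody.BoseGas.cellN N L, conj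 (Ψ.ψ (Function.update X i (X i + r))) * Ψ.ψ X).re; ∃ c : ℝ, (∑ j : Fin 3 → Fin m, |Real.log (G (Literature.MathematicalPhysics.QuantumManyBody.BoseGas.latticeVec (L / m) (fun k => ((j k : ℕ) : ℤ)))) - c| * ((L / m) / (1 + ∑ k, ((min (j k : ℕ) (m - (j k : ℕ)) : ℕ) : ℝ) ^ 2))) ≤ C

/-- (−1)-moment of the NEGATIVE part of the grid Lévy weights (quantitative infrared infinite
divisibility at every grid scale): the crux with `max(−ν̃_q,0)` in place of `max(ν̃_q,0)`. -/
def LevyNegativePartMoment : Prop :=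
  ∀ v : ℝ → ENNReal, Literature.MathematicalPhysics.QuantumManyBody.BoseGas.IsRepulsiveFiniteRange v → ∀ η : ℝ, 0 < η → ∃ C : ℝ, ∃ ρ₀ : ℝ, 0 < ρ₀ ∧ ∀ ρ : ℝ, 0 < ρ → ρ < ρ₀ → ∀ᶠ N : ℕ in Filter.atTop, ∃ δ : ENNReal, 0 < δ ∧ ∀ Ψ : Literature.MathematicalPhysics.QuantumManyBody.BoseGas.PeriodicTrialState N (Literature.MathematicalPhysics.QuantumManyBody.BoseGas.sideLength ρ N), Literature.MathematicalPhysics.QuantumManyBody.BoseGas.periodicEnergy v Ψ ≤ Literature.MathematicalPhysics.QuantumManyBody.BoseGas.periodicGroundStateEnergy v N (Literature.MathematicalPhysics.QuantumManyBody.BoseGas.sideLength ρ N) + δ → ∀ i : Fin N, let L : ℝ := Literature.MathematicalPhysics.QuantumManyBody.BoseGas.sideLength ρ N; let m : ℕ := ⌊L / η⌋₊; let G : EuclideanSpace ℝ (Fin 3) → ℝ := fun r => (∫ X in Literature.MathematicalPhysics.QuantumManyBody.BoseGas.cellN N L, conj (Ψ.ψ (Function.update X i (X i + r))) * Ψ.ψ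 X).re; let ν : (Fin 3 → Fin m) → ℝ := fun q => (∑ j : Fin 3 → Fin m, Real.log (G (Literature.MathematicalPhysics.QuantumManyBody.BoseGas.latticeVec (L / m) (fun k => ((j k : ℕ) : ℤ)))) * Real.cos (2 * Real.pi * (∑ k, ((q k : ℕ) : ℝ) * ((j k : ℕ) : ℝ)) / m)) / (m : ℝ) ^ 3; (∑ q : Fin 3 → Fin m with (∃ k, (q k : ℕ) ≠ 0), max (-(ν q)) 0 / (2 * Real.pi / L * Real.sqrt (∑ k, ((min (q k : ℕ) (m - (q k : ℕ)) : ℕ) : ℝ) ^ 2))) ≤ C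

/-- L-FREE RIESZ SUM BOUND (pure discrete harmonic analysis, the analytic heart of stub 1):
`|Σ_(q≢0) cos(2π q·j/m)/‖q̄‖| ≤ A·m²/(1 + ‖j‖²_per)` with an absolute constant `A`, for all `m` and `j`. -/
def RieszSumBound : Prop :=
  ∃ A : ℝ, 0 ≤ A ∧ ∀ (m : ℕ) (j : Fin 3 → Fin m), |∑ q : Fin 3 → Fin m with (∃ k, (q k : ℕ) ≠ 0), Real.cos (2 * Real.pi * (∑ k, ((q k : ℕ) : ℝ) * ((j k : ℕ) : ℝ)) / m) / Real.sqrt (∑ k, ((min (q k : ℕ) (m - (q k : ℕ)) : ℕ) : ℝ) ^ 2)| ≤ A * (m : ℝ) ^ 2 / (1 + ∑ k, ((min (j k : ℕ) (m - (j k : ℕ)) : ℕ) : ℝ) ^ 2)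

/-- ROOTS OF UNITY (the zero-mean mechanism of stub 1): for `q ≢ 0 (mod m)` the grid sum of
`cos(2π q·j/m)` over `j ∈ (ℤ/m)³` vanishes. -/
def CosSumVanishes : Prop :=
  ∀ (m : ℕ) (q : Fin 3 → Fin m), (∃ k, (q k : ℕ) ≠ 0) → ∑ j : Fin 3 → Fin m, Real.cos (2 * Real.pi * (∑ k, ((q k : ℕ) : ℝ) * ((j k : ℕ) : ℝ)) / m) = 0

-- stub 1a `stub_rieszSum` LANDED (lead, 2026-08-17): imported from
-- `Theorems/BECInfDivCoherenceLevyNegativeMomentRieszSum.lean` (helper chain `…Riesz{Abel,Calculus,Bars,OneDim,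
-- TwoDim,Split,Assembly}.lean`, constant A = 560); the name resolves in this namespace.

-- stub 1b `stub_cosSumVanishes` LANDED (p143925, worker W1, 2026-08-17): imported from
-- `Theorems/BECInfDivCoherenceLevyNegativeMomentCosSumVanishes.lean` (alias of the sister crux's
-- `Theorems.stub_gridCharacterSum`); the name resolves in this namespace.

/-- Rescaling `L/(2π m³)` out of the kernel: the two L-free stubs give `RieszKernelBound`
(with constant `A/(2π)`). Kernel-checked, no sorry. -/
theorem rieszKernelBound_of : RieszSumBound → CosSumVanishes → RieszKernelBound := by
  intro hS hZ
  obtain ⟨A, hA, H⟩ := hS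
  refine ⟨A / (2 * Real.pi), div_nonneg hA (by positivity), fun m L hL => ⟨fun j => ?_, ?_⟩⟩
  · -- the bound
    rcases Nat.eq_zero_or_pos m with hm | hm
    · subst hm; exact (Fin.elim0 (j 0) : False).elim
    have hm' : (0 : ℝ) < m := Nat.cast_pos.mpr hm
    have key : ∀ q : Fin 3 → Fin m,
        Real.cos (2 * Real.pi * (∑ k, ((q k : ℕ) : ℝ) * ((j k : ℕ) : ℝ)) / m) / (m : ℝ) ^ 3 /
            (2 * Real.pi / L * Real.sqrt (∑ k, ((min (q k : ℕ) (m - (q k : ℕ)) : ℕ) : ℝ) ^ 2))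
          = L / (2 * Real.pi * (m : ℝ) ^ 3) *
            (Real.cos (2 * Real.pi * (∑ k, ((q k : ℕ) : ℝ) * ((j k : ℕ) : ℝ)) / m) /
              Real.sqrt (∑ k, ((min (q k : ℕ) (m - (q k : ℕ)) : ℕ) : ℝ) ^ 2)) := by
      intro q
      have hπ : Real.pi ≠ 0 := Real.pi_ne_zero
      have hL' : L ≠ 0 := hL.ne'
      have hm'' : (m : ℝ) ≠ 0 := hm'.ne'
      generalize Real.sqrt (∑ k, ((min (q k : ℕ) (m - (q k : ℕ)) : ℕ) : ℝ) ^ 2) = s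
      generalize Real.cos (2 * Real.pi * (∑ k, ((q k : ℕ) : ℝ) * ((j k : ℕ) : ℝ)) / m) = c
      rcases eq_or_ne s 0 with hs | hs
      · subst hs; simp
      · field_simp
    rw [Finset.sum_congr rfl fun q _ => key q, ← Finset.mul_sum, abs_mul,
      abs_of_pos (by positivity : (0 : ℝ) < L / (2 * Real.pi * (m : ℝ) ^ 3))]
    calc L / (2 * Real.pi * (m : ℝ) ^ 3) *
          |∑ q : Fin 3 → Fin m with (∃ k, (q k : ℕ) ≠ 0), Real.cos (2 * Real.pi * (∑ k, ((q k : ℕ) : ℝ) * ((j k : ℕ) : ℝ)) / m) / Real.sqrt (∑ k, ((min (q k : ℕ) (m - (q k : ℕ)) : ℕ) : ℝ) ^ 2)|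
        ≤ L / (2 * Real.pi * (m : ℝ) ^ 3) *
          (A * (m : ℝ) ^ 2 / (1 + ∑ k, ((min (j k : ℕ) (m - (j k : ℕ)) : ℕ) : ℝ) ^ 2)) :=
          mul_le_mul_of_nonneg_left (H m j) (by positivity)
      _ = A / (2 * Real.pi) * ((L / m) / (1 + ∑ k, ((min (j k : ℕ) (m - (j k : ℕ)) : ℕ) : ℝ) ^ 2)) := by
          have hW : (0 : ℝ) < 1 + ∑ k, ((min (j k : ℕ) (m - (j k : ℕ)) : ℕ) : ℝ) ^ 2 := by positivity
          field_simp
  · -- zero mean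
    rw [Finset.sum_comm]
    refine Finset.sum_eq_zero fun q hq => ?_
    have hq' : ∃ k, (q k : ℕ) ≠ 0 := (Finset.mem_filter.mp hq).2
    rw [← Finset.sum_div, ← Finset.sum_div, hZ m q hq', zero_div, zero_div]

/-- stub 1 (derived, no sorry of its own): grid Riesz kernel bound + zero mean. -/
theorem stub_rieszKernel : RieszKernelBound :=
  rieszKernelBound_of stub_rieszSum stub_cosSumVanishes

/-- stub 2 [XL, hardest]: weighted-ℓ¹ log-cluster bound for near-minimisers (= `LogClusterL1`, unfolded). -/
theorem stub_logClusterL1 : ∀ v : ℝ → ENNReal, Literature.MathematicalPhysics.QuantumManyBody.BoseGas.IsRepulsiveFiniteRange v → ∀ η : ℝ, 0 < η → ∃ C : ℝ, ∃ ρ₀ : ℝ, 0 < ρ₀ ∧ ∀ ρ : ℝ, 0 < ρ → ρ < ρ₀ → ∀ᶠ N : ℕ in Filter.atTop, ∃ δ : ENNReal, 0 < δ ∧ ∀ Ψ : Literature.MathematicalPhysics.QuantumManyBody.BoseGas.PeriodicTrialState N (Literature.MathematicalPhysics.QuantumManyBody.BoseGas.sideLength ρ N), Literature.MathematicalPhysics.QuantumManyBody.BoseGas.periodicEnergy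 v Ψ ≤ Literature.MathematicalPhysics.QuantumManyBody.BoseGas.periodicGroundStateEnergy v N (Literature.MathematicalPhysics.QuantumManyBody.BoseGas.sideLength ρ N) + δ → ∀ i : Fin N, let L : ℝ := Literature.MathematicalPhysics.QuantumManyBody.BoseGas.sideLength ρ N; let m : ℕ := ⌊L / η⌋₊; let G : EuclideanSpace ℝ (Fin 3) → ℝ := fun r => (∫ X in Literature.MathematicalPhysics.QuantumManyBody.BoseGas.cellN N L, conj (Ψ.ψ (Function.update X i (X i + r))) * Ψ.ψ X).re; ∃ c : ℝ, (∑ j : Fin 3 → Fin m, |Real.log (G (Literature.MathematicalPhysics.QuantumManyBody.BoseGas.latticeVec (L / m) (fun k => ((j k : ℕ) : ℤ)))) - c| * ((L / m) / (1 + ∑ k, ((min (j k : ℕ) (m - (j k : ℕ)) : ℕ) : ℝ) ^ 2))) ≤ C := by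
  sorry

/-- stub 3 [M/L]: Schoenberg defect — (−1)-moment of the negative Lévy weights (= `LevyNegativePartMoment`, unfolded). -/
theorem stub_schoenbergDefect : ∀ v : ℝ → ENNReal, Literature.MathematicalPhysics.QuantumManyBody.BoseGas.IsRepulsiveFiniteRange v → ∀ η : ℝ, 0 < η → ∃ C : ℝ, ∃ ρ₀ : ℝ, 0 < ρ₀ ∧ ∀ ρ : ℝ, 0 < ρ → ρ < ρ₀ → ∀ᶠ N : ℕ in Filter.atTop, ∃ δ : ENNReal, 0 < δ ∧ ∀ Ψ : Literature.MathematicalPhysics.QuantumManyBody.BoseGas.PeriodicTrialState N (Literature.MathematicalPhysics.QuantumManyBody.BoseGas.sideLength ρ N), Literature.MathematicalPhysics.QuantumManyBody.BoseGas.periodicEnergy v Ψ ≤ Literature.MathematicalPhysics.QuantumManyBody.BoseGas.periodicGroundStateEnergy v N (Literature.MathematicalPhysics.QuantumManyBody.BoseGas.sideLength ρ N) + δ → ∀ i : Fin N, let L : ℝ := Literature.MathematicalPhysics.QuantumManyBody.BoseGas.sideLength ρ N; let m : ℕ := ⌊L / η⌋₊; let G : EuclideanSpace ℝ (Fin 3)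 → ℝ := fun r => (∫ X in Literature.MathematicalPhysics.QuantumManyBody.BoseGas.cellN N L, conj (Ψ.ψ (Function.update X i (X i + r))) * Ψ.ψ X).re; let ν : (Fin 3 → Fin m) → ℝ := fun q => (∑ j : Fin 3 → Fin m, Real.log (G (Literature.MathematicalPhysics.QuantumManyBody.BoseGas.latticeVec (L / m) (fun k => ((j k : ℕ) : ℤ)))) * Real.cos (2 * Real.pi * (∑ k, ((q k : ℕ) : ℝ) * ((j k : ℕ) : ℝ)) / m)) / (m : ℝ) ^ 3; (∑ q : Fin 3 → Fin m with (∃ k, (q k : ℕ) ≠ 0), max (-(ν q)) 0 / (2 * Real.pi / L * Real.sqrt (∑ k, ((min (q k : ℕ) (m - (q k : ℕ)) : ℕ) : ℝ) ^ 2))) ≤ C := by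
  sorry

/-- Exchange of the two finite sums, centring by the zero-mean kernel, domination:
`Σ_q (Σ_j F_j cos θ_qj)/M/D_q = Σ_j (F_j − c)·K_j ≤ A·Σ_j |F_j − c| w_j`. -/
theorem signed_le {ι κ : Type*} [Fintype ι] {s : Finset κ} {F : ι → ℝ} {θ : κ → ι → ℝ} {M : ℝ}
    {D : κ → ℝ} {w : ι → ℝ} {A C c : ℝ}
    (hA : 0 ≤ A)
    (hK : ∀ j, |∑ q ∈ s, Real.cos (θ q j) / M / D q| ≤ A * w j)
    (hK0 : ∑ j, (∑ q ∈ s, Real.cos (θ q j) / M / D q) = 0)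
    (hF : ∑ j, |F j - c| * w j ≤ C) :
    ∑ q ∈ s, (∑ j, F j * Real.cos (θ q j)) / M / D q ≤ A * C := by
  have e1 : ∑ q ∈ s, (∑ j, F j * Real.cos (θ q j)) / M / D q
      = ∑ j, F j * (∑ q ∈ s, Real.cos (θ q j) / M / D q) := by
    have h1 : ∀ q ∈ s, (∑ j, F j * Real.cos (θ q j)) / M / D q
        = ∑ j, F j * (Real.cos (θ q j) / M / D q) := by
      intro q _
      rw [Finset.sum_div, Finset.sum_div]
      refine Finset.sum_congr rfl fun j _ => ?_
      ring
    rw [Finset.sum_congr rfl h1, Finset.sum_comm]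
    refine Finset.sum_congr rfl fun j _ => ?_
    rw [Finset.mul_sum]
  have e2 : ∑ j, F j * (∑ q ∈ s, Real.cos (θ q j) / M / D q)
      = ∑ j, (F j - c) * (∑ q ∈ s, Real.cos (θ q j) / M / D q) := by
    have h3 : ∑ j, (F j - c) * (∑ q ∈ s, Real.cos (θ q j) / M / D q)
        = ∑ j, F j * (∑ q ∈ s, Real.cos (θ q j) / M / D q)
          - c * ∑ j, (∑ q ∈ s, Real.cos (θ q j) / M / D q) := by
      rw [Finset.mul_sum, ← Finset.sum_sub_distrib]
      refine Finset.sum_congr rfl fun j _ => ?_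
      ring
    rw [h3, hK0, mul_zero, sub_zero]
  rw [e1, e2]
  calc ∑ j, (F j - c) * (∑ q ∈ s, Real.cos (θ q j) / M / D q)
      ≤ ∑ j, |F j - c| * (A * w j) := by
        refine Finset.sum_le_sum fun j _ => ?_
        calc (F j - c) * (∑ q ∈ s, Real.cos (θ q j) / M / D q)
            ≤ |(F j - c) * (∑ q ∈ s, Real.cos (θ q j) / M / D q)| := le_abs_self _
          _ = |F j - c| * |∑ q ∈ s, Real.cos (θ q j) / M / D q| := abs_mul _ _
          _ ≤ |F j - c| * (A * w j) := mul_le_mul_of_nonneg_left (hK j) (abs_nonneg _)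
    _ = A * ∑ j, |F j - c| * w j := by
        rw [Finset.mul_sum]
        refine Finset.sum_congr rfl fun j _ => ?_
        ring
    _ ≤ A * C := mul_le_mul_of_nonneg_left hF hA

/-- Jordan seam: `max x 0 = x + max (−x) 0` under the division and the finite sum. -/
theorem sum_max_div_le {ι : Type*} {s : Finset ι} {f d : ι → ℝ} {C₁ C₂ : ℝ}
    (h₁ : ∑ q ∈ s, f q / d q ≤ C₁) (h₂ : ∑ q ∈ s, max (-(f q)) 0 / d q ≤ C₂) :
    ∑ q ∈ s, max (f q) 0 / d q ≤ C₁ + C₂ := by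
  have key : ∀ q ∈ s, max (f q) 0 / d q = f q / d q + max (-(f q)) 0 / d q := by
    intro q _
    rw [← add_div]
    congr 1
    rcases le_total 0 (f q) with h | h
    · rw [max_eq_left h, max_eq_right (neg_nonpos.mpr h), add_zero]
    · rw [max_eq_right h, max_eq_left (neg_nonneg.mpr h), add_neg_cancel]
  rw [Finset.sum_congr rfl key, Finset.sum_add_distrib]
  exact add_le_add h₁ h₂

/-- COMPOSITION (kernel-checked, no sorry): the three stubs give the crux BY NAME. -/
theorem LevyNegativeMoment_of :
    RieszKernelBound → LogClusterL1 → LevyNegativePartMoment → Summit.AtomisticToContinuum.BoseEinsteinCondensation.Theses.BECInfDivCoherence.LevyNegativeMoment := by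
  intro hK h₁ h₂ v hv η hη
  obtain ⟨A, hA, HK⟩ := hK
  obtain ⟨C₁, ρ₁, hρ₁, H₁⟩ := h₁ v hv η hη
  obtain ⟨C₂, ρ₂, hρ₂, H₂⟩ := h₂ v hv η hη
  refine ⟨A * C₁ + C₂, min ρ₁ ρ₂, lt_min hρ₁ hρ₂, fun ρ hρ hρlt => ?_⟩
  have E₁ := H₁ ρ hρ (lt_of_lt_of_le hρlt (min_le_left _ _))
  have E₂ := H₂ ρ hρ (lt_of_lt_of_le hρlt (min_le_right _ _))
  filter_upwards [E₁, E₂, Filter.eventually_gt_atTop 0] with N hN₁ hN₂ hN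
  obtain ⟨δ₁, hδ₁, K₁⟩ := hN₁
  obtain ⟨δ₂, hδ₂, K₂⟩ := hN₂
  refine ⟨min δ₁ δ₂, lt_min hδ₁ hδ₂, fun Ψ hΨ i => ?_⟩
  have P₁ := K₁ Ψ (hΨ.trans (add_le_add le_rfl (min_le_left _ _))) i
  have P₂ := K₂ Ψ (hΨ.trans (add_le_add le_rfl (min_le_right _ _))) i
  have hL : 0 < Literature.MathematicalPhysics.QuantumManyBody.BoseGas.sideLength ρ N := by
    unfold Literature.MathematicalPhysics.QuantumManyBody.BoseGas.sideLength
    exact Real.rpow_pos_of_pos (div_pos (Nat.cast_pos.mpr hN) hρ) _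
  obtain ⟨PKb, PK0⟩ := HK ⌊Literature.MathematicalPhysics.QuantumManyBody.BoseGas.sideLength ρ N / η⌋₊
    (Literature.MathematicalPhysics.QuantumManyBody.BoseGas.sideLength ρ N) hL
  dsimp only at P₁ P₂ ⊢
  try dsimp only at PKb
  try dsimp only at PK0
  obtain ⟨c, P₁⟩ := P₁
  exact sum_max_div_le (signed_le hA PKb PK0 P₁) P₂

/-- REGISTERED TARGET of the skeleton — the crux BY NAME with no hypotheses: `LevyNegativeMoment_of`
applied to the three declared stubs (the only `sorry`s of the file live in `stub_*`; `#print axioms` of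
this theorem reaches `sorryAx` exactly through them).  `#h21_check_skeleton` keys on a hypothesis-free
theorem; `LevyNegativeMoment_of` is the kernel-checked composition it packages. -/
theorem LevyNegativeMoment_of_stubs :
    Summit.AtomisticToContinuum.BoseEinsteinCondensation.Theses.BECInfDivCoherence.LevyNegativeMoment :=
  LevyNegativeMoment_of stub_rieszKernel stub_logClusterL1 stub_schoenbergDefect

end Summit.AtomisticToContinuum.BoseEinsteinCondensation.Cruxes.LevyNegativeMoment.Birth
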